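/-
Copyright (c) 2026 the pub-hodgecm-mathlib formalisation cell (harness21).  Prover seat hodgecm-mathlib-K2Liu-p26 (g3), Track B «K2-LIT»,
#184♮ = hLiu418 = `stmt-HodgeConjecture-24832`; socket #41 `sig_K2LiuSiegelEisensteinContinuation`, KIND W, brick (KW-fin-size) (LEAD F0P6-plan (g15) BATCH #182 (1),
KW desk F0P2-p08 (g3)): the per-place SIZE letter `hsizeLoc` of ★ p863047 `hfsize_of_placeLetters` ∕ ★ p863485 `kindW_block_cm_of_localLetters` for the letter of
record `Ffin := kindWFfin …` (★ p863154), from three per-place letters in LOCAL currency (radius-stability, sup, Haar volume) and the shared level data.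
THEOREMS ONLY (no `def`, no `instance`, no notation, no named-fact hypothesis, no `sorry`).
-/
import Summits.HodgeConjecture.HodgeConjecture.Theorems.K2LiuKindWFiniteLetterDefs          -- ★ p863154 (iii-fin) `kindWFfin`, `kindWLocalBall`, (T3) `kindWFfin_eq_setIntegral_of_stable`
import Summits.HodgeConjecture.HodgeConjecture.Theorems.K2LiuKindWFinitePartLettersOfRecord  -- ★ p863047 `hfsize_of_placeLetters` (the consumer's currency: `GLn.localHeight`, `PlacesOver` as a `Fintype`)
import HarnessLib

/-!
# Crux `HLiu418`, socket #41, KIND W — brick (KW-fin-size) `K2LiuKindWFiniteSizeLetterOfPlace`: THE PER-PLACE SIZE LETTER `hsizeLoc` FOR `Ffin := kindWFfin`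
# from RADIUS-STABILITY, SUP and HAAR-VOLUME letters in local currency

Cell `hodgecm-mathlib`, crux item hLiu418 = `stmt-HodgeConjecture-24832` (helper lane `--supports … --as helper`, count-neutral), route of record
`HCCMUnconditional`; squad K2 ∕ K2Liu, road `K2_Liu`, socket #41, KIND W; LEAD F0P6-plan (g15) BATCH #182 (1), KW desk F0P2-p08 (g3).

THE SLOT.  ★ p863485 `K2LiuKindWBlockOfRecordCMOfLocalLetters.kindW_block_cm_of_localLetters` (:151–:162) takes, besides the shared (iii-fin) LEVEL data
`lev Tδ₀ δ₀ hδ₀ k hlev` (:141–:144), uniform exponents `k₂ k₃`, a fixed finite defect set `Tβ` and the per-place SIZE letter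
`hsizeLoc : ∀ z, 0 < re z → ∃ r k₁ β, 0 < r ∧ (β = 0 off Tβ) ∧ ∀ j S s, dist s z < r → ∀ h v, v ∈ kindWFinset T₀ ↑S h → ∀ dS dA, (|S_{ab}|_w ≤ q_w^{dS w}) →
(|S⁻¹_{ab}|_w ≤ q_w^{dA w}) → ‖Ffin j S h v s‖ ≤ ∏_{w ∣ v} N(𝔭_w)^{β w} · H_w(h)^{k₁} · N(𝔭_w)^{k₂ dS w + k₃ dA w}` (★ p863047 `hfsize_of_placeLetters` turns it into the head's `hfsize`).
At the tie `Ffin j S h v s := if det ↑S = 0 then 0 else kindWFfin T₀ νv ϖ FvT j S h v s` (★ p863154, in the KW desk's reading of record ★∕📤 p863658 ED. 2 §3 after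
K2E3-p37 (g3)'s flag (F-det) «far-shell stability fails at singular `S`»; read pointwise by `hreadF` in those bytes, `π` generic): at `det ↑S ≠ 0` the LIMIT of the ball integrals
`∫_{ball(−k)} conj ψ_S(ι_v y) · FvT j S h v s (w_{Δ,v} · y · h_v) dν_v` with the local factors `FvT` BY VALUE.  No bound on a `limUnder` exists without STABILITY, and with `FvT`
by value the honest per-place inputs are three letters in LOCAL currency, each with a named payer road:
* (R) **radius-stability** `hstab` (at `det ↑S ≠ 0`): the ball integrals are constant beyond a radius `R ≤ Σ_{w∣v} (ρ w + a₁·lev h w + a₂·dS w + a₃·dA w)` (`ρ` supported on a fixed `Tρ`, `a₁ a₂ a₃`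
  uniform) — payer (iii-fin-Φ5): Karel's lemma ★ `K2LiuBadPlaceWhittakerEntire.whittaker_setIntegral_ball_eq` (`K₁ + 4b + 2b′`) through ★ B4;
* (B) **sup, locally uniformly in `s`** `hsup`: on `w_{Δ,v} · ball(−a) · h_v`, `‖FvT j S h v s‖ ≤ (∏_{w∣v} N(𝔭_w)^{β w} H_w(h)^{k₁}) · N(v)^{b₁ a}` (`β` supported on a fixed `Tβ`, `b₁`
  uniform) — payer: the (KW-fac) reading ★ p863379 §3 (`Λ_{s,v}`, `H_v^{2(s−s₀)}·b`);
* (V) **Haar volume of the balls** `hvol`: `ν_v(ball(−a)) ≤ (∏_{w∣v} N(𝔭_w)^{ρν w}) · N(v)^{dν a}` (`ρν` supported on a fixed `Tν`) — payer: the carriers' Haar normalisation (★ p862988).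
THIS FILE is the arithmetic from (R)(B)(V) + `hlev` to the slot, hypothesis-first (no analysis):
* §1 tools — `one_le_absNorm_cast`, **`absNorm_cast_le_of_placesOver`** (`N(v) ≤ N(𝔭_w)` for `w ∣ v`: Mathlib `Ideal.absNorm_pow_inertiaDeg` + `inertiaDeg_pos`; this kills the
  cross terms of the fibre `{w ∣ v}`), `pow_sum_le_prod_pow_placesOver` (`N(v)^{c·Σ_w t_w} ≤ ∏_w N(𝔭_w)^{c·t_w}`), `perPlace_le` (the per-place exponent bookkeeping with `hlev`);
* §2 **`hsizeLoc_of_place`** — the slot BYTES with `k₂ := (dν + b₁)·a₂`, `k₃ := (dν + b₁)·a₃`, `Tβ := Tβ ∪ Tν ∪ Tρ ∪ Tδ₀` (inside: `β′ := β + ρν + (dν+b₁)(ρ + a₁ δ₀)`,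
  `k₁′ := k₁ + (dν+b₁) a₁ k`).  Proof: singular `S` ⇒ `‖0‖ ≤` a product of non-negative reals; else `hreadF` + ★ (T3) `kindWFfin_eq_setIntegral_of_stable` at `K := R`, Mathlib `norm_setIntegral_le_of_norm_le_const` (`‖conj ψ‖ = 1`,
  the ball has finite measure by (V)), `R ≤ Σ`, `N(v)^Σ = ∏ N(v)^{t_w} ≤ ∏ N(𝔭_w)^{t_w}`, then `hlev` place by place.
Generic `n` (`e : Fin N × Fin M ≃ Fin n`), generic uniformisers `π` (no `hπ` needed), default heartbeats except the head (the ★ (T3) letter block, measured below).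
[KudlaRallis1994, §2], [Shimura1997, §18.4 Prop. 18.14], [Casselman1980, §3], [MoeglinWaldspurger1995, IV.1.9], [NeukirchANT1999, Ch. I §8, Ch. III §1], [BorelJacquet1979, §1.2].
HONEST LABEL.  Count-neutral helper; closes no socket by itself: `HC_CM` is proved only modulo the 7 printed citations (2 remaining named inputs:
hLiu418 = `stmt-HodgeConjecture-24832`, h413 = `stmt-HodgeConjecture-24833`) until rung 0 closes.  NOT HERE (by value): the three letters (R)(B)(V) for the concrete factors.
-/

set_option autoImplicit false
-- the mandated namespace repeats the single-problem summit's segment (`HodgeConjecture.HodgeConjecture`)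
set_option linter.dupNamespace false

noncomputable section

open scoped Matrix RestrictedProduct ENNReal NNReal Topology ComplexConjugate BigOperators
-- `Classical`: the `Finset` unions of places and the `if v ∈ kindWFinset …` of the letter of record (as ★ p863154 ∕ ★ p863047)
open scoped Classical
open NumberField IsDedekindDomain MeasureTheory Measure Filter Set

namespace Summit.HodgeConjecture.HodgeConjecture.Cruxes.HLiu418.K2LiuKindWFiniteSizeLetterOfPlace

open Literature.NumberTheory.Automorphic Literature.NumberTheory.GaloisRepresentations Literature.NumberTheory.LFunctions
open Literature.NumberTheory.GelbartRogawski1991 Literature.NumberTheory.GelbartRogawski1991.GRConstruction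
open Literature.NumberTheory.GelbartRogawski1991.AdaptedBlocks
open Literature.NumberTheory.GelbartRogawski1991.UnitaryDualPair Literature.NumberTheory.GelbartRogawski1991.UnitaryDualPair.LocalSplitting
open Literature.NumberTheory.K2Lit.SiegelDoubled
open Literature.NumberTheory.K2Lit.PlaceSplitting
open Literature.MeasureTheory.RestrictedProduct
open Summit.HodgeConjecture.HodgeConjecture.Cruxes.HLiu418.K2LiuSiegelUnipotentLocalDefs
open Summit.HodgeConjecture.HodgeConjecture.Cruxes.HLiu418.K2LiuSiegelUnipotentSplitDefs
open Summit.HodgeConjecture.HodgeConjecture.Cruxes.HLiu418.K2LiuSiegelUnipotentSplitAtDefs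
open Summit.HodgeConjecture.HodgeConjecture.Cruxes.HLiu418.K2LiuSiegelUnipotentFourierDefs
open Summit.HodgeConjecture.HodgeConjecture.Cruxes.HLiu418.K2LiuSiegelEisensteinKindWLetters
open Summit.HodgeConjecture.HodgeConjecture.Cruxes.HLiu418.K2LiuKindWFiniteLetterDefs (kindWFfin kindWLocalBall kindWFfin_eq_setIntegral_of_stable)

/-! ## §1 Tools: norms in the fibre `w ∣ v`, and the per-place exponent bookkeeping -/

section Tools

variable (L : Type) [Field L] [NumberField L] [IsCMField L]

omit [IsCMField L] in
/-- `1 ≤ N(v)` for a finite place `v` of `L⁺` (a non-zero ideal has non-zero absolute norm). [cite: NeukirchANT1999, Ch. I §6] -/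
theorem one_le_absNorm_cast (v : HeightOneSpectrum (𝓞 (Fp L))) : (1 : ℝ) ≤ ((Ideal.absNorm v.asIdeal : ℕ) : ℝ) := by
  have h0 : Ideal.absNorm v.asIdeal ≠ 0 := fun h => v.ne_bot (Ideal.absNorm_eq_zero_iff.1 h)
  exact_mod_cast Nat.one_le_iff_ne_zero.2 h0

omit [IsCMField L] in
/-- **`N(v) ≤ N(𝔭_w)` for `w ∣ v`**: `N(𝔭_w) = N(v)^{f(w∣v)}` with `f(w∣v) ≥ 1` (Mathlib `Ideal.absNorm_pow_inertiaDeg`, `Ideal.inertiaDeg_pos`). [cite: NeukirchANT1999, Ch. I §8] -/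
theorem absNorm_cast_le_of_placesOver (v : HeightOneSpectrum (𝓞 (Fp L))) (w : UnitaryGroup.PlacesOver L v) :
    ((Ideal.absNorm v.asIdeal : ℕ) : ℝ) ≤ ((Ideal.absNorm w.1.asIdeal : ℕ) : ℝ) := by
  haveI : w.1.asIdeal.LiesOver v.asIdeal := ⟨congrArg HeightOneSpectrum.asIdeal w.2.symm⟩
  have hpow : Ideal.absNorm v.asIdeal ^ w.1.asIdeal.inertiaDeg (𝓞 (Fp L)) = Ideal.absNorm w.1.asIdeal :=
    Ideal.absNorm_pow_inertiaDeg v.asIdeal w.1.asIdeal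
  have hf : 0 < w.1.asIdeal.inertiaDeg (𝓞 (Fp L)) := Ideal.inertiaDeg_pos w.1.asIdeal (𝓞 (Fp L))
  have h : Ideal.absNorm v.asIdeal ≤ Ideal.absNorm w.1.asIdeal := by
    calc Ideal.absNorm v.asIdeal ≤ Ideal.absNorm v.asIdeal ^ w.1.asIdeal.inertiaDeg (𝓞 (Fp L)) := Nat.le_self_pow hf.ne' _
      _ = Ideal.absNorm w.1.asIdeal := hpow
  exact_mod_cast h

omit [IsCMField L] in
/-- **`N(v)^{c·Σ_{w∣v} t_w} ≤ ∏_{w∣v} N(𝔭_w)^{c·t_w}`** (`N(v)^{Σ} = ∏ N(v)^{t_w}` and `N(v) ≤ N(𝔭_w)` factor by factor) — the fibre's cross terms are absorbed.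
[cite: NeukirchANT1999, Ch. I §8] -/
theorem pow_sum_le_prod_pow_placesOver (v : HeightOneSpectrum (𝓞 (Fp L))) (c : ℕ) (t : UnitaryGroup.PlacesOver L v → ℕ) :
    ((Ideal.absNorm v.asIdeal : ℕ) : ℝ) ^ (c * ∑ w : UnitaryGroup.PlacesOver L v, t w) ≤
      ∏ w : UnitaryGroup.PlacesOver L v, ((Ideal.absNorm w.1.asIdeal : ℕ) : ℝ) ^ (c * t w) := by
  rw [Finset.mul_sum, ← Finset.prod_pow_eq_pow_sum]
  exact Finset.prod_le_prod (fun w _ => pow_nonneg (Nat.cast_nonneg _) _)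
    fun w _ => pow_le_pow_left₀ (Nat.cast_nonneg _) (absNorm_cast_le_of_placesOver L v w) _

omit [NumberField L] [IsCMField L] in
/-- **the per-place exponent bookkeeping**: with the level letter `N^{lev} ≤ N^{δ₀} · H^k` (★ p863485's `hlev` at one place),
`N^β H^{k₁} · N^{ρν} · N^{c(ρ + a₁ lev + a₂ dS + a₃ dA)} ≤ N^{β + ρν + c(ρ + a₁ δ₀)} · H^{k₁ + c a₁ k} · N^{c a₂ dS + c a₃ dA}` for reals `N ≥ 1`, `H ≥ 0`.
[cite: Shimura1997, §18.4 Prop. 18.14] -/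
theorem perPlace_le {Nw Hw : ℝ} (hN : 1 ≤ Nw) (hH : 0 ≤ Hw) {β ρν ρ δ₀ lev dS dA k k₁ a₁ a₂ a₃ c : ℕ}
    (hlev : Nw ^ lev ≤ Nw ^ δ₀ * Hw ^ k) :
    Nw ^ β * Hw ^ k₁ * Nw ^ ρν * Nw ^ (c * (ρ + a₁ * lev + a₂ * dS + a₃ * dA)) ≤
      Nw ^ (β + ρν + c * (ρ + a₁ * δ₀)) * Hw ^ (k₁ + c * a₁ * k) * Nw ^ (c * a₂ * dS + c * a₃ * dA) := by
  have hN0 : 0 ≤ Nw := zero_le_one.trans hN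
  have hexp : c * (ρ + a₁ * lev + a₂ * dS + a₃ * dA) = c * ρ + lev * (c * a₁) + (c * a₂ * dS + c * a₃ * dA) := by ring
  have hpow : (Nw ^ lev) ^ (c * a₁) ≤ (Nw ^ δ₀ * Hw ^ k) ^ (c * a₁) := pow_le_pow_left₀ (pow_nonneg hN0 _) hlev _
  calc Nw ^ β * Hw ^ k₁ * Nw ^ ρν * Nw ^ (c * (ρ + a₁ * lev + a₂ * dS + a₃ * dA))
      = Nw ^ β * Hw ^ k₁ * Nw ^ ρν * (Nw ^ (c * ρ) * (Nw ^ lev) ^ (c * a₁) * Nw ^ (c * a₂ * dS + c * a₃ * dA)) := by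
        rw [hexp, pow_add, pow_add, pow_mul Nw lev (c * a₁)]
    _ ≤ Nw ^ β * Hw ^ k₁ * Nw ^ ρν * (Nw ^ (c * ρ) * (Nw ^ δ₀ * Hw ^ k) ^ (c * a₁) * Nw ^ (c * a₂ * dS + c * a₃ * dA)) := by
        gcongr
    _ = Nw ^ (β + ρν + c * (ρ + a₁ * δ₀)) * Hw ^ (k₁ + c * a₁ * k) * Nw ^ (c * a₂ * dS + c * a₃ * dA) := by
        rw [mul_pow, ← pow_mul, ← pow_mul, show c * (ρ + a₁ * δ₀) = c * ρ + δ₀ * (c * a₁) by ring,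
          show k₁ + c * a₁ * k = k₁ + k * (c * a₁) by ring, pow_add, pow_add, pow_add, pow_add]
        ring

omit [IsCMField L] in
/-- **the fibre bookkeeping** (pure arithmetic over `{w ∣ v}`): from `μ ≤ (∏_w N^{ρν}) · N(v)^{dν R}`, `R ≤ Σ_w (ρ + a₁ lev + a₂ dS + a₃ dA)`, `N(v) ≤ N(𝔭_w)` and the level
letter `N^{lev} ≤ N^{δ₀} H_w^k` at every `w ∣ v`:
`(∏_w N^{β} H_w^{k₁}) · N(v)^{b₁ R} · μ ≤ ∏_w N^{β + ρν + (dν+b₁)(ρ + a₁ δ₀)} · H_w^{k₁ + (dν+b₁) a₁ k} · N^{(dν+b₁) a₂ dS + (dν+b₁) a₃ dA}`.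
[cite: Shimura1997, §18.4 Prop. 18.14] [cite: NeukirchANT1999, Ch. I §8] -/
theorem fibre_bound (v : HeightOneSpectrum (𝓞 (Fp L))) (H : UnitaryGroup.PlacesOver L v → ℝ) (hH : ∀ w, 0 ≤ H w)
    (β ρν ρ δ₀ lev dS dA : HeightOneSpectrum (𝓞 L) → ℕ) (k k₁ a₁ a₂ a₃ dν b₁ R : ℕ)
    (hlev : ∀ w : UnitaryGroup.PlacesOver L v,
      ((Ideal.absNorm w.1.asIdeal : ℕ) : ℝ) ^ lev w.1 ≤ ((Ideal.absNorm w.1.asIdeal : ℕ) : ℝ) ^ δ₀ w.1 * H w ^ k)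
    (hR : R ≤ ∑ w : UnitaryGroup.PlacesOver L v, (ρ w.1 + a₁ * lev w.1 + a₂ * dS w.1 + a₃ * dA w.1)) {μr : ℝ}
    (hμ : μr ≤ (∏ w : UnitaryGroup.PlacesOver L v, ((Ideal.absNorm w.1.asIdeal : ℕ) : ℝ) ^ ρν w.1) * ((Ideal.absNorm v.asIdeal : ℕ) : ℝ) ^ (dν * R)) :
    (∏ w : UnitaryGroup.PlacesOver L v, ((Ideal.absNorm w.1.asIdeal : ℕ) : ℝ) ^ β w.1 * H w ^ k₁) * ((Ideal.absNorm v.asIdeal : ℕ) : ℝ) ^ (b₁ * R) * μr ≤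
      ∏ w : UnitaryGroup.PlacesOver L v, ((Ideal.absNorm w.1.asIdeal : ℕ) : ℝ) ^ (β w.1 + ρν w.1 + (dν + b₁) * (ρ w.1 + a₁ * δ₀ w.1)) * H w ^ (k₁ + (dν + b₁) * a₁ * k) *
        ((Ideal.absNorm w.1.asIdeal : ℕ) : ℝ) ^ ((dν + b₁) * a₂ * dS w.1 + (dν + b₁) * a₃ * dA w.1) := by
  have hq0 : ∀ w : HeightOneSpectrum (𝓞 L), (0 : ℝ) ≤ ((Ideal.absNorm w.asIdeal : ℕ) : ℝ) := fun w => Nat.cast_nonneg _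
  have hNv1 : (1 : ℝ) ≤ ((Ideal.absNorm v.asIdeal : ℕ) : ℝ) := one_le_absNorm_cast L v
  have hNv0 : (0 : ℝ) ≤ ((Ideal.absNorm v.asIdeal : ℕ) : ℝ) := zero_le_one.trans hNv1
  have hPβ0 : 0 ≤ ∏ w : UnitaryGroup.PlacesOver L v, ((Ideal.absNorm w.1.asIdeal : ℕ) : ℝ) ^ β w.1 * H w ^ k₁ :=
    Finset.prod_nonneg fun w _ => mul_nonneg (pow_nonneg (hq0 _) _) (pow_nonneg (hH w) _)
  have hPν0 : 0 ≤ ∏ w : UnitaryGroup.PlacesOver L v, ((Ideal.absNorm w.1.asIdeal : ℕ) : ℝ) ^ ρν w.1 := Finset.prod_nonneg fun w _ => pow_nonneg (hq0 _) _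
  have hRpow : ((Ideal.absNorm v.asIdeal : ℕ) : ℝ) ^ ((dν + b₁) * R) ≤
      ((Ideal.absNorm v.asIdeal : ℕ) : ℝ) ^ ((dν + b₁) * ∑ w : UnitaryGroup.PlacesOver L v, (ρ w.1 + a₁ * lev w.1 + a₂ * dS w.1 + a₃ * dA w.1)) :=
    pow_le_pow_right₀ hNv1 (Nat.mul_le_mul_left _ hR)
  have hfib := pow_sum_le_prod_pow_placesOver L v (dν + b₁) (fun w => ρ w.1 + a₁ * lev w.1 + a₂ * dS w.1 + a₃ * dA w.1)
  calc (∏ w : UnitaryGroup.PlacesOver L v, ((Ideal.absNorm w.1.asIdeal : ℕ) : ℝ) ^ β w.1 * H w ^ k₁) * ((Ideal.absNorm v.asIdeal : ℕ) : ℝ) ^ (b₁ * R) * μr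
      ≤ (∏ w : UnitaryGroup.PlacesOver L v, ((Ideal.absNorm w.1.asIdeal : ℕ) : ℝ) ^ β w.1 * H w ^ k₁) * ((Ideal.absNorm v.asIdeal : ℕ) : ℝ) ^ (b₁ * R) *
          ((∏ w : UnitaryGroup.PlacesOver L v, ((Ideal.absNorm w.1.asIdeal : ℕ) : ℝ) ^ ρν w.1) * ((Ideal.absNorm v.asIdeal : ℕ) : ℝ) ^ (dν * R)) :=
        mul_le_mul_of_nonneg_left hμ (mul_nonneg hPβ0 (pow_nonneg hNv0 _))
    _ = (∏ w : UnitaryGroup.PlacesOver L v, ((Ideal.absNorm w.1.asIdeal : ℕ) : ℝ) ^ β w.1 * H w ^ k₁) *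
          (∏ w : UnitaryGroup.PlacesOver L v, ((Ideal.absNorm w.1.asIdeal : ℕ) : ℝ) ^ ρν w.1) * ((Ideal.absNorm v.asIdeal : ℕ) : ℝ) ^ ((dν + b₁) * R) := by
        rw [show (dν + b₁) * R = b₁ * R + dν * R by ring, pow_add]; ring
    _ ≤ (∏ w : UnitaryGroup.PlacesOver L v, ((Ideal.absNorm w.1.asIdeal : ℕ) : ℝ) ^ β w.1 * H w ^ k₁) *
          (∏ w : UnitaryGroup.PlacesOver L v, ((Ideal.absNorm w.1.asIdeal : ℕ) : ℝ) ^ ρν w.1) *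
          ((Ideal.absNorm v.asIdeal : ℕ) : ℝ) ^ ((dν + b₁) * ∑ w : UnitaryGroup.PlacesOver L v, (ρ w.1 + a₁ * lev w.1 + a₂ * dS w.1 + a₃ * dA w.1)) :=
        mul_le_mul_of_nonneg_left hRpow (mul_nonneg hPβ0 hPν0)
    _ ≤ (∏ w : UnitaryGroup.PlacesOver L v, ((Ideal.absNorm w.1.asIdeal : ℕ) : ℝ) ^ β w.1 * H w ^ k₁) *
          (∏ w : UnitaryGroup.PlacesOver L v, ((Ideal.absNorm w.1.asIdeal : ℕ) : ℝ) ^ ρν w.1) *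
          ∏ w : UnitaryGroup.PlacesOver L v, ((Ideal.absNorm w.1.asIdeal : ℕ) : ℝ) ^ ((dν + b₁) * (ρ w.1 + a₁ * lev w.1 + a₂ * dS w.1 + a₃ * dA w.1)) :=
        mul_le_mul_of_nonneg_left hfib (mul_nonneg hPβ0 hPν0)
    _ = ∏ w : UnitaryGroup.PlacesOver L v, (((Ideal.absNorm w.1.asIdeal : ℕ) : ℝ) ^ β w.1 * H w ^ k₁ * ((Ideal.absNorm w.1.asIdeal : ℕ) : ℝ) ^ ρν w.1 *
          ((Ideal.absNorm w.1.asIdeal : ℕ) : ℝ) ^ ((dν + b₁) * (ρ w.1 + a₁ * lev w.1 + a₂ * dS w.1 + a₃ * dA w.1))) := by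
        rw [← Finset.prod_mul_distrib, ← Finset.prod_mul_distrib]
    _ ≤ _ := by
        refine Finset.prod_le_prod (fun w _ => ?_) fun w _ => ?_
        · exact mul_nonneg (mul_nonneg (mul_nonneg (pow_nonneg (hq0 _) _) (pow_nonneg (hH w) _)) (pow_nonneg (hq0 _) _)) (pow_nonneg (hq0 _) _)
        · exact perPlace_le (hNv1.trans (absNorm_cast_le_of_placesOver L v w)) (hH w) (hlev w)

end Tools

/-! ## §2 The size letter `hsizeLoc` for `Ffin := kindWFfin` from the letters (R)(B)(V) and `hlev` -/

section Size

variable (L : Type) [Field L] [NumberField L] [IsCMField L]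
variable {N M n : ℕ} (e : Fin N × Fin M ≃ Fin n)
  (dV : Fin N → L) (hdV : ∀ i, IsCMField.complexConj L (dV i) = dV i)
  (dW : Fin M → L) (hdW : ∀ i, IsCMField.complexConj L (dW i) = dW i)
variable [∀ v : HeightOneSpectrum (𝓞 (Fp L)), MeasurableSpace ↥(unipDeltaLoc L e dV hdV dW hdW v)]

set_option maxHeartbeats 800000 in -- MEASURED: 400 000 ✗ (deterministic timeout at `whnf` of the statement — the ★ (T3) `hstable` letter block ×2 + ★ p863485's dependent `FvT` ∕ `Ffin` blocks) ∕ 800 000 ✓; scoped to this one decl; proof = `rw` + one `refine … .trans (fibre_bound …)` (no search tactics)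
/-- **(KW-fin-size) THE PER-PLACE SIZE LETTER `hsizeLoc` OF ★ p863485 ∕ ★ p863047 FOR `Ffin := kindWFfin`, FROM LOCAL LETTERS.**  INPUT (all BY VALUE, per place, in the
tree's currency): the letter of record in the `if det ↑S = 0 then 0 else kindWFfin …` reading (`hreadF`, ★∕📤 p863658 §3 bytes at generic `n`, any uniformisers `π`); the SHARED level data `lev Tδ₀ δ₀ hδ₀ k hlev` (★ p863485 :141–:144 verbatim);
(V) the Haar-volume letter of the balls `hvol` (`ρν` supported on `Tν`, growth `N(v)^{dν a}`); (R) the radius-stability letter `hstab` at `det ↑S ≠ 0` (the ★ (T3) ball integrals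
at `s` are constant beyond a radius `R ≤ Σ_{w∣v}(ρ w + a₁ lev h w + a₂ dS w + a₃ dA w)`, `ρ` supported on `Tρ`); (B) the sup letter `hsup` (on `w_{Δ,v}·ball(−a)·h_v`,
`‖FvT‖ ≤ (∏_{w∣v} N(𝔭_w)^{β w} H_w(h)^{k₁})·N(v)^{b₁ a}`, locally uniformly in `s`, `β` supported on `Tβ`).
OUTPUT: the slot's `hsizeLoc` BYTES with `k₂ := (dν + b₁) * a₂`, `k₃ := (dν + b₁) * a₃`, `Tβ := Tβ ∪ Tν ∪ Tρ ∪ Tδ₀`.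
[cite: KudlaRallis1994, §2] [cite: Shimura1997, §18.4 Prop. 18.14] [cite: Casselman1980, §3] [cite: MoeglinWaldspurger1995, IV.1.9] -/
theorem hsizeLoc_of_place
    (T₀ : Finset (HeightOneSpectrum (𝓞 (Fp L))))
    (νv : ∀ v : HeightOneSpectrum (𝓞 (Fp L)), Measure ↥(unipDeltaLoc L e dV hdV dW hdW v))
    (π : ∀ v : HeightOneSpectrum (𝓞 (Fp L)), v.adicCompletion (Fp L)) {m : ℕ}
    (FvT : Fin m → ∀ (S : skewMatrices ((IsCMField.complexConj L : L ≃ₐ[Fp L] L) : L →+* L) ((gramR L e dV hdV dW hdW).map (algebraMap (Fp L) L)))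
      (h : HA L e dV hdV dW hdW) (v : (kindWFinset L e dV hdV dW hdW T₀ (S : Matrix (Fin n) (Fin n) L) h)),
      ℂ → UnitaryGroup.localPi L (IsCMField.complexConj L) (n + n) (hermD L e dV hdV dW hdW) v.1 → ℂ)
    (Ffin : Fin m → skewMatrices ((IsCMField.complexConj L : L ≃ₐ[Fp L] L) : L →+* L) ((gramR L e dV hdV dW hdW).map (algebraMap (Fp L) L)) → HA L e dV hdV dW hdW →
      HeightOneSpectrum (𝓞 (Fp L)) → ℂ → ℂ)
    (hreadF : ∀ (j : Fin m) (S : skewMatrices ((IsCMField.complexConj L : L ≃ₐ[Fp L] L) : L →+* L) ((gramR L e dV hdV dW hdW).map (algebraMap (Fp L) L)))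
      (h : HA L e dV hdV dW hdW) (v : HeightOneSpectrum (𝓞 (Fp L))) (s : ℂ),
      Ffin j S h v s = if (S : Matrix (Fin n) (Fin n) L).det = 0 then 0 else kindWFfin L e dV hdV dW hdW T₀ νv π FvT j S h v s)
    -- the SHARED (iii-fin) level data (★ p863485 :141–:144 verbatim)
    (lev : HA L e dV hdV dW hdW → HeightOneSpectrum (𝓞 L) → ℕ) (Tδ₀ : Finset (HeightOneSpectrum (𝓞 L))) (δ₀ : HeightOneSpectrum (𝓞 L) → ℕ) (hδ₀ : ∀ w ∉ Tδ₀, δ₀ w = 0) (k : ℕ)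
    (hlev : ∀ (h : HA L e dV hdV dW hdW) (w : HeightOneSpectrum (𝓞 L)),
      ((Ideal.absNorm w.asIdeal : ℕ) : ℝ) ^ lev h w ≤ ((Ideal.absNorm w.asIdeal : ℕ) : ℝ) ^ δ₀ w * (GLn.localHeight (n + n) L w (h : GL (Fin (n + n)) (AdeleRing (𝓞 L) L)) : ℝ) ^ k)
    -- (V) the Haar volume of the balls
    (Tν : Finset (HeightOneSpectrum (𝓞 L))) (ρν : HeightOneSpectrum (𝓞 L) → ℕ) (hρν : ∀ w ∉ Tν, ρν w = 0) (dν : ℕ)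
    (hvol : ∀ (v : HeightOneSpectrum (𝓞 (Fp L))) (a : ℕ), νv v (kindWLocalBall L e dV hdV dW hdW v (π v) (-(a : ℤ))) ≤
      ENNReal.ofReal ((∏ w : UnitaryGroup.PlacesOver L v, ((Ideal.absNorm w.1.asIdeal : ℕ) : ℝ) ^ ρν w.1) * ((Ideal.absNorm v.asIdeal : ℕ) : ℝ) ^ (dν * a)))
    -- (R) radius-stability of the ball integrals of the integrand of record
    (Tρ : Finset (HeightOneSpectrum (𝓞 L))) (ρ : HeightOneSpectrum (𝓞 L) → ℕ) (hρ : ∀ w ∉ Tρ, ρ w = 0) (a₁ a₂ a₃ : ℕ)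
    (hstab : ∀ (j : Fin m) (S : skewMatrices ((IsCMField.complexConj L : L ≃ₐ[Fp L] L) : L →+* L) ((gramR L e dV hdV dW hdW).map (algebraMap (Fp L) L)))
      (h : HA L e dV hdV dW hdW) (v : (kindWFinset L e dV hdV dW hdW T₀ (S : Matrix (Fin n) (Fin n) L) h)), (S : Matrix (Fin n) (Fin n) L).det ≠ 0 →
      ∀ (s : ℂ) (dS dA : HeightOneSpectrum (𝓞 L) → ℕ),
      (∀ (w : UnitaryGroup.PlacesOver L v.1) (a b : Fin n), Valued.v ((((S : Matrix (Fin n) (Fin n) L) a b : L)) : w.1.adicCompletion L) ≤ WithZero.exp ((dS w.1 : ℕ) : ℤ)) →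
      (∀ (w : UnitaryGroup.PlacesOver L v.1) (a b : Fin n), Valued.v ((((S : Matrix (Fin n) (Fin n) L)⁻¹ a b : L)) : w.1.adicCompletion L) ≤ WithZero.exp ((dA w.1 : ℕ) : ℤ)) →
      ∃ R : ℕ, R ≤ ∑ w : UnitaryGroup.PlacesOver L v.1, (ρ w.1 + a₁ * lev h w.1 + a₂ * dS w.1 + a₃ * dA w.1) ∧
        ∀ k' : ℕ, R ≤ k' →
          ∫ y in kindWLocalBall L e dV hdV dW hdW v.1 (π v.1) (-(k' : ℤ)),
            conj (unipDeltaChar L e dV hdV dW hdW (S : Matrix (Fin n) (Fin n) L)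
                (locToAdelic L e dV hdV dW hdW v.1
                  ((y : ↥(unipDeltaLoc L e dV hdV dW hdW v.1)) : UnitaryGroup.localPi L (IsCMField.complexConj L) (n + n) (hermD L e dV hdV dW hdW) v.1)) : ℂ) *
              FvT j S h v s (UnitaryGroup.evalPlace (Fp L) L (IsCMField.complexConj L) (n + n) (hermD L e dV hdV dW hdW) v.1
                    (UnitaryGroup.finPart (Fp L) L (IsCMField.complexConj L) (n + n) (hermD L e dV hdV dW hdW) (weylDelta L e dV hdV dW hdW)) *
                  ((y : ↥(unipDeltaLoc L e dV hdV dW hdW v.1)) : UnitaryGroup.localPi L (IsCMField.complexConj L) (n + n) (hermD L e dV hdV dW hdW) v.1) *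
                  UnitaryGroup.evalPlace (Fp L) L (IsCMField.complexConj L) (n + n) (hermD L e dV hdV dW hdW) v.1
                    (UnitaryGroup.finPart (Fp L) L (IsCMField.complexConj L) (n + n) (hermD L e dV hdV dW hdW) h)) ∂(νv v.1) =
          ∫ y in kindWLocalBall L e dV hdV dW hdW v.1 (π v.1) (-(R : ℤ)),
            conj (unipDeltaChar L e dV hdV dW hdW (S : Matrix (Fin n) (Fin n) L)
                (locToAdelic L e dV hdV dW hdW v.1
                  ((y : ↥(unipDeltaLoc L e dV hdV dW hdW v.1)) : UnitaryGroup.localPi L (IsCMField.complexConj L) (n + n) (hermD L e dV hdV dW hdW) v.1)) : ℂ) *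
              FvT j S h v s (UnitaryGroup.evalPlace (Fp L) L (IsCMField.complexConj L) (n + n) (hermD L e dV hdV dW hdW) v.1
                    (UnitaryGroup.finPart (Fp L) L (IsCMField.complexConj L) (n + n) (hermD L e dV hdV dW hdW) (weylDelta L e dV hdV dW hdW)) *
                  ((y : ↥(unipDeltaLoc L e dV hdV dW hdW v.1)) : UnitaryGroup.localPi L (IsCMField.complexConj L) (n + n) (hermD L e dV hdV dW hdW) v.1) *
                  UnitaryGroup.evalPlace (Fp L) L (IsCMField.complexConj L) (n + n) (hermD L e dV hdV dW hdW) v.1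
                    (UnitaryGroup.finPart (Fp L) L (IsCMField.complexConj L) (n + n) (hermD L e dV hdV dW hdW) h)) ∂(νv v.1))
    -- (B) the sup letter on `w_Δ · ball(−a) · h_v`, locally uniformly in `s`
    (b₁ : ℕ) (Tβ : Finset (HeightOneSpectrum (𝓞 L)))
    (hsup : ∀ z : ℂ, 0 < z.re → ∃ (r : ℝ) (k₁ : ℕ) (β : HeightOneSpectrum (𝓞 L) → ℕ), 0 < r ∧ (∀ w ∉ Tβ, β w = 0) ∧
      ∀ (j : Fin m) (S : skewMatrices ((IsCMField.complexConj L : L ≃ₐ[Fp L] L) : L →+* L) ((gramR L e dV hdV dW hdW).map (algebraMap (Fp L) L))) (s : ℂ),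
      dist s z < r → ∀ (h : HA L e dV hdV dW hdW) (v : (kindWFinset L e dV hdV dW hdW T₀ (S : Matrix (Fin n) (Fin n) L) h)) (a : ℕ)
        (y : ↥(unipDeltaLoc L e dV hdV dW hdW v.1)), y ∈ kindWLocalBall L e dV hdV dW hdW v.1 (π v.1) (-(a : ℤ)) →
        ‖FvT j S h v s (UnitaryGroup.evalPlace (Fp L) L (IsCMField.complexConj L) (n + n) (hermD L e dV hdV dW hdW) v.1
              (UnitaryGroup.finPart (Fp L) L (IsCMField.complexConj L) (n + n) (hermD L e dV hdV dW hdW) (weylDelta L e dV hdV dW hdW)) *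
            ((y : ↥(unipDeltaLoc L e dV hdV dW hdW v.1)) : UnitaryGroup.localPi L (IsCMField.complexConj L) (n + n) (hermD L e dV hdV dW hdW) v.1) *
            UnitaryGroup.evalPlace (Fp L) L (IsCMField.complexConj L) (n + n) (hermD L e dV hdV dW hdW) v.1
              (UnitaryGroup.finPart (Fp L) L (IsCMField.complexConj L) (n + n) (hermD L e dV hdV dW hdW) h))‖ ≤
          (∏ w : UnitaryGroup.PlacesOver L v.1,
              ((Ideal.absNorm w.1.asIdeal : ℕ) : ℝ) ^ β w.1 * (GLn.localHeight (n + n) L w.1 (h : GL (Fin (n + n)) (AdeleRing (𝓞 L) L)) : ℝ) ^ k₁) *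
            ((Ideal.absNorm v.1.asIdeal : ℕ) : ℝ) ^ (b₁ * a)) :
    ∀ z : ℂ, 0 < z.re → ∃ (r : ℝ) (k₁ : ℕ) (β : HeightOneSpectrum (𝓞 L) → ℕ), 0 < r ∧ (∀ w ∉ Tβ ∪ Tν ∪ Tρ ∪ Tδ₀, β w = 0) ∧
      ∀ (j : Fin m) (S : skewMatrices ((IsCMField.complexConj L : L ≃ₐ[Fp L] L) : L →+* L) ((gramR L e dV hdV dW hdW).map (algebraMap (Fp L) L))) (s : ℂ),
      dist s z < r → ∀ (h : HA L e dV hdV dW hdW) (v : HeightOneSpectrum (𝓞 (Fp L))), v ∈ kindWFinset L e dV hdV dW hdW T₀ (S : Matrix (Fin n) (Fin n) L) h →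
      ∀ (dS dA : HeightOneSpectrum (𝓞 L) → ℕ),
        (∀ (w : UnitaryGroup.PlacesOver L v) (a b : Fin n), Valued.v ((((S : Matrix (Fin n) (Fin n) L) a b : L)) : w.1.adicCompletion L) ≤ WithZero.exp ((dS w.1 : ℕ) : ℤ)) →
        (∀ (w : UnitaryGroup.PlacesOver L v) (a b : Fin n), Valued.v ((((S : Matrix (Fin n) (Fin n) L)⁻¹ a b : L)) : w.1.adicCompletion L) ≤ WithZero.exp ((dA w.1 : ℕ) : ℤ)) →
        ‖Ffin j S h v s‖ ≤ ∏ w : UnitaryGroup.PlacesOver L v,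
          ((Ideal.absNorm w.1.asIdeal : ℕ) : ℝ) ^ β w.1 * (GLn.localHeight (n + n) L w.1 (h : GL (Fin (n + n)) (AdeleRing (𝓞 L) L)) : ℝ) ^ k₁ *
            ((Ideal.absNorm w.1.asIdeal : ℕ) : ℝ) ^ ((dν + b₁) * a₂ * dS w.1 + (dν + b₁) * a₃ * dA w.1) := by
  intro z hz
  obtain ⟨r, k₁, β, hr, hβ, hB⟩ := hsup z hz
  refine ⟨r, k₁ + (dν + b₁) * a₁ * k, fun w => β w + ρν w + (dν + b₁) * (ρ w + a₁ * δ₀ w), hr, fun w hw => ?_, ?_⟩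
  · simp only [Finset.notMem_union] at hw
    obtain ⟨⟨⟨h1, h2⟩, h3⟩, h4⟩ := hw
    simp only [hβ w h1, hρν w h2, hρ w h3, hδ₀ w h4, mul_zero, add_zero]
  intro j S s hs h v hv dS dA hdS hdA
  -- singular `S`: the letter of record reads `0` (K2E3-p37 (g3) (F-det): far-shell stability fails at singular indices)
  by_cases hdet : (S : Matrix (Fin n) (Fin n) L).det = 0
  · rw [hreadF, if_pos hdet, norm_zero]
    exact Finset.prod_nonneg fun w _ =>
      mul_nonneg (mul_nonneg (pow_nonneg (Nat.cast_nonneg _) _) (pow_nonneg (NNReal.coe_nonneg _) _)) (pow_nonneg (Nat.cast_nonneg _) _)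
  -- (R): the letter of record is the ball integral at the stable radius `R`
  obtain ⟨R, hRle, hRstab⟩ := hstab j S h ⟨v, hv⟩ hdet s dS dA hdS hdA
  rw [hreadF, if_neg hdet, kindWFfin_eq_setIntegral_of_stable L e dV hdV dW hdW T₀ νv π FvT j S h ⟨v, hv⟩ s R hRstab]
  -- (V): the ball has finite, controlled measure
  have hvolR := hvol v R
  have hX0 : 0 ≤ (∏ w : UnitaryGroup.PlacesOver L v, ((Ideal.absNorm w.1.asIdeal : ℕ) : ℝ) ^ ρν w.1) * ((Ideal.absNorm v.asIdeal : ℕ) : ℝ) ^ (dν * R) :=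
    mul_nonneg (Finset.prod_nonneg fun w _ => pow_nonneg (Nat.cast_nonneg _) _) (pow_nonneg (Nat.cast_nonneg _) _)
  have hfin : νv v (kindWLocalBall L e dV hdV dW hdW v (π v) (-(R : ℤ))) < ∞ := lt_of_le_of_lt hvolR ENNReal.ofReal_lt_top
  have hreal : (νv v).real (kindWLocalBall L e dV hdV dW hdW v (π v) (-(R : ℤ))) ≤
      (∏ w : UnitaryGroup.PlacesOver L v, ((Ideal.absNorm w.1.asIdeal : ℕ) : ℝ) ^ ρν w.1) * ((Ideal.absNorm v.asIdeal : ℕ) : ℝ) ^ (dν * R) := by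
    rw [measureReal_def]
    exact ENNReal.toReal_le_of_le_ofReal hX0 hvolR
  -- (B): `‖conj ψ_S · F‖ = ‖F‖ ≤ Pβ · N(v)^{b₁ R}` on the ball; then the fibre bookkeeping
  refine (norm_setIntegral_le_of_norm_le_const hfin fun y hy => ?_).trans
    (fibre_bound L v (fun w => (GLn.localHeight (n + n) L w.1 (h : GL (Fin (n + n)) (AdeleRing (𝓞 L) L)) : ℝ)) (fun w => NNReal.coe_nonneg _)
      β ρν ρ δ₀ (lev h) dS dA k k₁ a₁ a₂ a₃ dν b₁ R (fun w => hlev h w.1) hRle hreal)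
  rw [norm_mul, Complex.norm_conj, Circle.norm_coe, one_mul]
  exact hB j S s hs h ⟨v, hv⟩ R y hy

end Size

end Summit.HodgeConjecture.HodgeConjecture.Cruxes.HLiu418.K2LiuKindWFiniteSizeLetterOfPlace

end
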